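import Literature.Analysis.Complex.AnalyticFormalRoots
import Mathlib.RingTheory.LaurentSeries
import Mathlib.Analysis.Meromorphic.Basic
import HarnessLib

/-!
# Laurent expansion at `0` of germs of meromorphic functions

Topic `Literature/Analysis/Complex` (namespace `Literature.Analysis.Complex.LaurentGerm`).
Everything here is PROVED; there is no definition: the Laurent expansion of a germ `f` with a
pole of order `≤ n` at `0` is written through the local notation
`𝓛[n, f] = X^{-n} · 𝓣[zⁿ f] ∈ ℂ⸨X⸩`, where `𝓣[·]` is the Taylor series at `0`
(`AnalyticFormalRoots.lean`) and the hypothesis "`zⁿ f(z)` is analytic at `0`" plays the role of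
"`f` is meromorphic at `0` with a pole of order `≤ n`" (every function meromorphic at `0` in
Mathlib's sense `MeromorphicAt f 0` satisfies it for some `n`, by definition).

* `laurent_eq_of_analyticAt` — independence of `n`;
* `laurent_mul`, `laurent_add`, `laurent_neg`, `laurent_sub`, `laurent_const_mul`, `laurent_pow`
  — `𝓛` is a ring homomorphism on germs;
* `laurent_const`, `laurent_id`, `laurent_inv_pow`, `laurent_of_analyticAt` — values on
  constants, `z`, `z^{-k}`, analytic germs;
* `laurent_eq_zero_iff`, `laurent_congr` — `𝓛[n, f] = 0` iff `f = 0` on a punctured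
  neighbourhood of `0`; `𝓛` only depends on the germ of `f` on a punctured neighbourhood.

These make `ℂ⸨X⸩` (an honest field with Mathlib's `Algebra.trdeg`, `IntermediateField`, …)
available for transcendence arguments about germs of meromorphic functions (function-field
arguments on branches of analytic or algebraic curves). [folklore]

## References

* R. Remmert, *Theory of Complex Functions*, GTM 122, Springer 1991, Ch. 12 §1 (Laurent
  expansion at an isolated singularity; the field of germs of meromorphic functions). [folklore]
-/

noncomputable section

open Complex Filter Topology Set PowerSeries HahnSeries LaurentSeries
open scoped Nat

namespace Literature.Analysis.Complex

namespace LaurentGerm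

open Literature.NumberTheory.Transcendental.AndreCriterion (coeff_taylor constantCoeff_taylor
  taylor_congr taylor_add taylor_const_mul taylor_mul taylor_one taylor_pow)
open Literature.Analysis.Complex.FormalRoot (taylor_eq_zero_iff taylor_sub eventuallyEq_of_taylor_eq
  taylor_polynomial taylor_pow_id)

/-- The Taylor series of `f : ℂ → ℂ` at `0`, as a formal power series (local notation, as in
`AndreCriterionAnalyticProofs`). -/
local notation3 "𝓣[" f "]" =>
  (PowerSeries.mk fun n => ((Nat.factorial n : ℂ)⁻¹ * iteratedDeriv n f 0) : PowerSeries ℂ)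

/-- The Laurent expansion at `0` of a germ `f` with `zⁿ f(z)` analytic at `0`:
`X⁻ⁿ · 𝓣[zⁿ f]` (local notation). -/
local notation3 "𝓛[" n ", " f "]" =>
  (HahnSeries.single (-((n : ℕ) : ℤ)) (1 : ℂ) *
    HahnSeries.ofPowerSeries ℤ ℂ 𝓣[fun z : ℂ => z ^ (n : ℕ) * (f : ℂ → ℂ) z] : LaurentSeries ℂ)

/-! ### Independence of the exponent -/

/-- Raising the exponent: `𝓣[z^{n+k} f] = X^k 𝓣[zⁿ f]`. [folklore] -/
theorem taylor_pow_add {f : ℂ → ℂ} {n : ℕ} (hf : AnalyticAt ℂ (fun z => z ^ n * f z) 0) (k : ℕ) :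
    𝓣[fun z : ℂ => z ^ (n + k) * f z] = PowerSeries.X ^ k * 𝓣[fun z : ℂ => z ^ n * f z] := by
  have hfun : (fun z : ℂ => z ^ (n + k) * f z) = (fun z : ℂ => z ^ k) * fun z => z ^ n * f z := by
    funext z; simp only [Pi.mul_apply]; ring
  have hzk : AnalyticAt ℂ (fun z : ℂ => z ^ k) 0 := analyticAt_id.pow k
  rw [hfun, taylor_mul hzk hf, taylor_pow_id]

/-- The analyticity hypothesis is stable under raising the exponent. [folklore] -/
theorem analyticAt_pow_add {f : ℂ → ℂ} {n : ℕ} (hf : AnalyticAt ℂ (fun z => z ^ n * f z) 0)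
    (k : ℕ) : AnalyticAt ℂ (fun z : ℂ => z ^ (n + k) * f z) 0 := by
  have hfun : (fun z : ℂ => z ^ (n + k) * f z) = fun z => z ^ k * (z ^ n * f z) := by
    funext z; ring
  rw [hfun]
  exact (analyticAt_id.pow k).mul hf

/-- **`𝓛[n, f]` does not depend on `n`** (as long as `zⁿ f` is analytic at `0`). [folklore] -/
theorem laurent_eq_of_analyticAt {f : ℂ → ℂ} {n m : ℕ}
    (hn : AnalyticAt ℂ (fun z => z ^ n * f z) 0) (hm : AnalyticAt ℂ (fun z => z ^ m * f z) 0) :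
    𝓛[n, f] = 𝓛[m, f] := by
  have key : ∀ {a : ℕ} (ha : AnalyticAt ℂ (fun z => z ^ a * f z) 0) (k : ℕ),
      𝓛[a + k, f] = 𝓛[a, f] := by
    intro a ha k
    rw [taylor_pow_add ha k, map_mul, map_pow, ofPowerSeries_X, single_pow, ← mul_assoc,
      single_mul_single]
    congr 1
    simp only [nsmul_eq_mul, mul_one, one_pow]
    congr 1
    push_cast
    ring
  rw [← key hn m, ← key hm n, Nat.add_comm]

/-! ### Ring operations -/

/-- **Multiplicativity**: `𝓛[n + m, f g] = 𝓛[n, f] · 𝓛[m, g]`. [folklore] -/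
theorem laurent_mul {f g : ℂ → ℂ} {n m : ℕ} (hf : AnalyticAt ℂ (fun z => z ^ n * f z) 0)
    (hg : AnalyticAt ℂ (fun z => z ^ m * g z) 0) :
    𝓛[n + m, fun z => f z * g z] = 𝓛[n, f] * 𝓛[m, g] := by
  have hfun : (fun z : ℂ => z ^ (n + m) * (f z * g z)) =
      (fun z : ℂ => z ^ n * f z) * fun z => z ^ m * g z := by
    funext z; simp only [Pi.mul_apply]; ring
  rw [hfun, taylor_mul hf hg, map_mul, mul_mul_mul_comm, single_mul_single, one_mul]
  congr 2
  push_cast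
  ring

/-- The analyticity hypothesis for a product. [folklore] -/
theorem analyticAt_mul {f g : ℂ → ℂ} {n m : ℕ} (hf : AnalyticAt ℂ (fun z => z ^ n * f z) 0)
    (hg : AnalyticAt ℂ (fun z => z ^ m * g z) 0) :
    AnalyticAt ℂ (fun z : ℂ => z ^ (n + m) * (f z * g z)) 0 := by
  have hfun : (fun z : ℂ => z ^ (n + m) * (f z * g z)) =
      (fun z : ℂ => z ^ n * f z) * fun z => z ^ m * g z := by
    funext z; simp only [Pi.mul_apply]; ring
  rw [hfun]; exact hf.mul hg

/-- **Powers**: `𝓛[n k, f^k] = 𝓛[n, f]^k`. [folklore] -/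
theorem laurent_pow {f : ℂ → ℂ} {n : ℕ} (hf : AnalyticAt ℂ (fun z => z ^ n * f z) 0) (k : ℕ) :
    𝓛[n * k, fun z => f z ^ k] = 𝓛[n, f] ^ k ∧
      AnalyticAt ℂ (fun z : ℂ => z ^ (n * k) * f z ^ k) 0 := by
  induction k with
  | zero =>
    have h1 : 𝓣[fun _ : ℂ => (1 : ℂ)] = 1 := taylor_one
    have hfun : (fun z : ℂ => z ^ (n * 0) * f z ^ 0) = fun _ => (1 : ℂ) := by
      funext z; simp
    refine ⟨?_, ?_⟩
    · beta_reduce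
      rw [hfun, h1, map_one (HahnSeries.ofPowerSeries ℤ ℂ), mul_one, pow_zero, Nat.mul_zero,
        Nat.cast_zero, neg_zero, single_zero_one]
    · rw [hfun]; exact analyticAt_const
  | succ k ih =>
    obtain ⟨ih1, ih2⟩ := ih
    beta_reduce at ih1 ⊢
    have hmul := laurent_mul ih2 hf
    have han := analyticAt_mul ih2 hf
    have e1 : n * (k + 1) = n * k + n := Nat.mul_succ n k
    have hfun : (fun z : ℂ => z ^ (n * (k + 1)) * f z ^ (k + 1)) =
        fun z => z ^ (n * k + n) * (f z ^ k * f z) := by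
      funext z; rw [e1]; ring
    refine ⟨?_, by rw [hfun]; exact han⟩
    rw [hfun, e1, hmul, ih1, pow_succ]

/-- **Additivity**: `𝓛[n, f + g] = 𝓛[n, f] + 𝓛[n, g]`. [folklore] -/
theorem laurent_add {f g : ℂ → ℂ} {n : ℕ} (hf : AnalyticAt ℂ (fun z => z ^ n * f z) 0)
    (hg : AnalyticAt ℂ (fun z => z ^ n * g z) 0) :
    𝓛[n, fun z => f z + g z] = 𝓛[n, f] + 𝓛[n, g] := by
  have hfun : (fun z : ℂ => z ^ n * (f z + g z)) =
      (fun z : ℂ => z ^ n * f z) + fun z => z ^ n * g z := by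
    funext z; simp only [Pi.add_apply]; ring
  rw [hfun, taylor_add hf hg, map_add, mul_add]

/-- The analyticity hypothesis for a sum. [folklore] -/
theorem analyticAt_add {f g : ℂ → ℂ} {n : ℕ} (hf : AnalyticAt ℂ (fun z => z ^ n * f z) 0)
    (hg : AnalyticAt ℂ (fun z => z ^ n * g z) 0) :
    AnalyticAt ℂ (fun z : ℂ => z ^ n * (f z + g z)) 0 := by
  have hfun : (fun z : ℂ => z ^ n * (f z + g z)) =
      (fun z : ℂ => z ^ n * f z) + fun z => z ^ n * g z := by
    funext z; simp only [Pi.add_apply]; ring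
  rw [hfun]; exact hf.add hg

/-- **Scalars**: `𝓛[n, c f] = C c · 𝓛[n, f]`. [folklore] -/
theorem laurent_const_mul {f : ℂ → ℂ} {n : ℕ} (c : ℂ) :
    𝓛[n, fun z => c * f z] = HahnSeries.C c * 𝓛[n, f] := by
  have hfun : (fun z : ℂ => z ^ n * (c * f z)) = fun z => c * (z ^ n * f z) := by
    funext z; ring
  rw [hfun, taylor_const_mul, map_mul, ofPowerSeries_C, mul_left_comm]

/-- The analyticity hypothesis for a scalar multiple. [folklore] -/
theorem analyticAt_const_mul {f : ℂ → ℂ} {n : ℕ} (hf : AnalyticAt ℂ (fun z => z ^ n * f z) 0)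
    (c : ℂ) : AnalyticAt ℂ (fun z : ℂ => z ^ n * (c * f z)) 0 := by
  have hfun : (fun z : ℂ => z ^ n * (c * f z)) = fun z => c * (z ^ n * f z) := by
    funext z; ring
  rw [hfun]; exact analyticAt_const.mul hf

/-- **Negation**: `𝓛[n, -f] = -𝓛[n, f]`. [folklore] -/
theorem laurent_neg {f : ℂ → ℂ} {n : ℕ} : 𝓛[n, fun z => -f z] = -𝓛[n, f] := by
  have h := laurent_const_mul (f := f) (n := n) (-1)
  simp only [neg_mul, one_mul] at h
  rw [h, map_neg, map_one, neg_mul, one_mul]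

/-- **Subtraction**: `𝓛[n, f - g] = 𝓛[n, f] - 𝓛[n, g]`. [folklore] -/
theorem laurent_sub {f g : ℂ → ℂ} {n : ℕ} (hf : AnalyticAt ℂ (fun z => z ^ n * f z) 0)
    (hg : AnalyticAt ℂ (fun z => z ^ n * g z) 0) :
    𝓛[n, fun z => f z - g z] = 𝓛[n, f] - 𝓛[n, g] := by
  have hg' : AnalyticAt ℂ (fun z : ℂ => z ^ n * (-g z)) 0 := by
    simpa using analyticAt_const_mul hg (-1)
  have h := laurent_add hf hg'
  simp only [← sub_eq_add_neg] at h
  rw [h, laurent_neg, sub_eq_add_neg]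

/-! ### Special germs -/

/-- An analytic germ: `𝓛[0, f] = 𝓣[f]`. [folklore] -/
theorem laurent_of_analyticAt (f : ℂ → ℂ) : 𝓛[0, f] = HahnSeries.ofPowerSeries ℤ ℂ 𝓣[f] := by
  simp only [pow_zero, one_mul, CharP.cast_eq_zero, neg_zero, single_zero_one]

/-- Constants: `𝓛[0, c] = C c`. [folklore] -/
theorem laurent_const (c : ℂ) : 𝓛[0, fun _ : ℂ => c] = HahnSeries.C c := by
  rw [laurent_of_analyticAt]
  have h := taylor_polynomial (Polynomial.C c)
  simp only [Polynomial.eval_C] at h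
  rw [h, Polynomial.coe_C, ofPowerSeries_C]

/-- The coordinate: `𝓛[0, z] = X`. [folklore] -/
theorem laurent_id : 𝓛[0, fun z : ℂ => z] = HahnSeries.single (1 : ℤ) (1 : ℂ) := by
  rw [laurent_of_analyticAt]
  have h := taylor_pow_id 1
  simp only [pow_one] at h
  rw [h, ofPowerSeries_X]

/-- Negative powers: `𝓛[k + 1, z^{-k}] = X^{-k}` (exponent `k + 1` so that the junk value
`0⁻¹ = 0` at the origin is irrelevant). [folklore] -/
theorem laurent_inv_pow (k : ℕ) :
    𝓛[k + 1, fun z : ℂ => (z ^ k)⁻¹] = HahnSeries.single (-(k : ℤ)) (1 : ℂ) ∧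
      AnalyticAt ℂ (fun z : ℂ => z ^ (k + 1) * (z ^ k)⁻¹) 0 := by
  have hfun : (fun z : ℂ => z ^ (k + 1) * (z ^ k)⁻¹) = fun z => z := by
    funext z
    by_cases hz : z = 0
    · subst hz; simp
    · rw [pow_succ, mul_comm, ← mul_assoc, inv_mul_cancel₀ (pow_ne_zero k hz), one_mul]
  refine ⟨?_, by rw [hfun]; exact analyticAt_id⟩
  rw [hfun]
  have h := taylor_pow_id 1
  simp only [pow_one] at h
  rw [h, ofPowerSeries_X, single_mul_single, mul_one]
  congr 1
  push_cast
  ring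

/-! ### The kernel: germs vanishing on a punctured neighbourhood -/

/-- An analytic germ vanishing on a punctured neighbourhood of `0` vanishes near `0`. [folklore] -/
theorem eventuallyEq_zero_of_puncture {F : ℂ → ℂ} (hF : AnalyticAt ℂ F 0)
    (h : ∀ᶠ z in 𝓝[≠] (0 : ℂ), F z = 0) : F =ᶠ[𝓝 0] 0 := by
  rcases hF.eventually_eq_zero_or_eventually_ne_zero with h0 | h0
  · exact h0
  · exfalso
    obtain ⟨z, hz1, hz2⟩ := (h0.and h).exists
    exact hz1 hz2

/-- **Kernel of the Laurent expansion**: `𝓛[n, f] = 0` iff `f` vanishes on a punctured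
neighbourhood of `0`. [folklore] -/
theorem laurent_eq_zero_iff {f : ℂ → ℂ} {n : ℕ} (hf : AnalyticAt ℂ (fun z => z ^ n * f z) 0) :
    𝓛[n, f] = 0 ↔ ∀ᶠ z in 𝓝[≠] (0 : ℂ), f z = 0 := by
  have hunit : (HahnSeries.single (-(n : ℤ)) (1 : ℂ) : LaurentSeries ℂ) ≠ 0 := by simp
  rw [mul_eq_zero, or_iff_right hunit, map_eq_zero_iff _ ofPowerSeries_injective,
    taylor_eq_zero_iff hf]
  constructor
  · intro h
    have h' : ∀ᶠ z in 𝓝[≠] (0 : ℂ), z ^ n * f z = 0 := eventually_nhdsWithin_of_eventually_nhds h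
    filter_upwards [h', self_mem_nhdsWithin] with z hz hz0
    exact (mul_eq_zero.1 hz).resolve_left (pow_ne_zero n hz0)
  · intro h
    apply eventuallyEq_zero_of_puncture hf
    filter_upwards [h] with z hz
    rw [hz, mul_zero]

/-- **The Laurent expansion only depends on the punctured germ.** [folklore] -/
theorem laurent_congr {f g : ℂ → ℂ} {n : ℕ} (hf : AnalyticAt ℂ (fun z => z ^ n * f z) 0)
    (hg : AnalyticAt ℂ (fun z => z ^ n * g z) 0) (h : ∀ᶠ z in 𝓝[≠] (0 : ℂ), f z = g z) :
    𝓛[n, f] = 𝓛[n, g] := by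
  rw [← sub_eq_zero, ← laurent_sub hf hg, laurent_eq_zero_iff]
  · filter_upwards [h] with z hz
    rw [hz, sub_self]
  · have hg' : AnalyticAt ℂ (fun z : ℂ => z ^ n * (-g z)) 0 := by
      simpa using analyticAt_const_mul hg (-1)
    simpa [sub_eq_add_neg] using analyticAt_add hf hg'

/-- Every germ meromorphic at `0` (Mathlib's `MeromorphicAt`) admits an exponent `n` with
`zⁿ f` analytic at `0`. [folklore] -/
theorem exists_analyticAt_pow_mul {f : ℂ → ℂ} (hf : MeromorphicAt f 0) :
    ∃ n : ℕ, AnalyticAt ℂ (fun z => z ^ n * f z) 0 := by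
  obtain ⟨n, hn⟩ := hf
  exact ⟨n, by simpa using hn⟩

end LaurentGerm

end Literature.Analysis.Complex

end
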